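import Mathlib.Analysis.Normed.Group.Int
import Mathlib.Analysis.SpecialFunctions.Exp
import Literature.Probability.LatticeModels.IsingThermodynamics
import HarnessLib

/-!
# The sharp length `L(β)`, the near-critical plateau upper bound, and the near-critical axial
# lower bound of Duminil-Copin–Panis (CMP 406 (2025), arXiv:2404.05700, Def. 1.1, eq. (1.4), Thm. 1.3)

Topic `Literature/Probability/LatticeModels`; family `crit-ising`. Companion of
`CriticalTwoPointDCPLower.lean` (which vendors Theorems 1.2–1.3 AT `β = β_c`): here the
near-critical range `β ≤ β_c`, `n ≤ L(β)` is recorded, which needs the **sharp length**.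

Setting (source §1, held text `paper:arxiv-2404.05700`, chunks 3–5): nearest-neighbour Ising
model on `ℤ^d`, finite-volume free-boundary measures `⟨·⟩_{Λ,β}` with weight
`exp(β Σ_{x∼y} τ_xτ_y)` — each bond ONCE (the random-current weight of §2.1 is
`w_β(n) = ∏_{{x,y}} β^{n_{xy}}/n_{xy}!`), i.e. the tree's `isingMeasure (zdGraph d) Λ β 0 .free`
with the SAME `β` — their weak limit `⟨·⟩_β` = the tree's `freeExpect d β 0` / `twoPointFree d β`,
`β_c := inf{β ≥ 0 : χ(β) = ∞}` = the tree's `criticalBeta d` (threshold equality: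
`criticalBeta_eq_sSup_susceptibility_finite_holds`), `|·|` the sup norm on `ℤ^d` (= Mathlib's Pi
norm `‖x‖` on `Site d = Fin d → ℤ`), `Λ_n = box d n`, `e₁ = Pi.single 0 1`,
`χ_m(β) = Σ_{x ∈ Λ_m} ⟨τ₀τ_x⟩_β`.

* **Definition 1.1 (sharp length)**, verbatim: "Let `β > 0`. Let `S` be a finite subset of `ℤ^d`
  containing `0` and set `φ_β(S) := β Σ_{x ∈ S, y ∉ S, y ∼ x} ⟨τ₀τ_x⟩_{S,β}`. Define the sharp
  length by `L(β) := inf{k ≥ 1 : ∃ S ⊂ ℤ^d, 0 ∈ S, diam(S) ≤ 2k, φ_β(S) < 1/2}`, where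
  `diam(S) := max{|x − y| : x, y ∈ S}`." Here: `dcpPhi d β S` (the inner sum depends on `x` only,
  so it is `#{y ∉ S : y ∼ x} · ⟨σ₀σ_x⟩_{S,β}` with the tree's finite-volume free two-point function
  `isingTwoPoint (zdGraph d) S β 0 .free 0 x`), `IsSharpLengthWitness d β k`, and
  `sharpLength d β : ℕ∞` (`inf ∅ = ⊤`, so `L(β_c) = ⊤` is a genuine value).
* **Eq. (1.4)** (display after Def. 1.1, "the Simon–Lieb inequality together with the infrared
  bound yield"): "there exist `c, C > 0` such that, if `β ≤ β_c` and `x ∈ ℤ^d ∖ {0}`,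
  `⟨τ₀τ_x⟩_β ≤ C (1/(|x| ∧ L(β)))^{d-2} exp(−c |x|/L(β))`." Vendored as
  `dcp_nearCritical_upper`, split on `L(β) = ⊤` (where the bound reads `C/|x|^{d-2}`, the
  infrared bound: `|x| ∧ ∞ = |x|`, `exp(−c|x|/∞) = 1`) and `L(β) = ℓ < ∞`; for `d ≥ 3` (the
  standing range of the infrared bound (1.3) used) and `0 ≤ β ≤ β_c`.
* **Theorem 1.3**, verbatim: "Let `d ≥ 3`. There exist `c₁, N₁ > 0` such that for all `β ≤ β_c`
  and for all `N₁ ≤ n ≤ L(β)`,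
  `⟨τ₀τ_{ne₁}⟩_β ≥ c₁ / ( χ_{4n}(β) + n^{d-2} Σ_{1≤k≤2n} k ⟨τ₀τ_{ke₁}⟩_β )`." Vendored as
  `dcp_twoPoint_axis_lower_nearCritical`, for `0 ≤ β ≤ β_c`, `N₁ ≤ n` and — the one deviation
  from the printed sentence, explained in the next item — **`4n ≤ L(β)`** (in `ℕ∞`) in place of
  the printed `n ≤ L(β)`, with the printed display as conclusion; its `β = β_c` slice is the
  accepted `dcp_criticalTwoPoint_axis_lower` (file `CriticalTwoPointDCPLower.lean`, not imported)
  as soon as `L(β_c) = ⊤` (`dcp_criticalTwoPoint_axis_lower_of_nearCritical`, proved, conclusion =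
  that fact's body; `4n ≤ ⊤` and `n ≤ ⊤` are the same condition).
* **Why `4n ≤ L(β)`: it is the range the printed proof of Theorem 1.3 establishes.** The sharp
  length enters the paper's argument at exactly one place, the display of §2.2 immediately
  before Lemma 2.4 (eq. (2.5) in the arXiv numbering used below): "By definition of `L(β)`, if
  `0 ≤ n ≤ L(β)` and `S ⊂ Λ_n`, then `φ_β(S) ≥ 1/2`. As a result, if `1 ≤ n ≤ L(β)`, then
  `½ 𝐏^∅_β[0 ∈ 𝒮_n] ≤ 𝐄^∅_β[𝟙_{0∈𝒮_n} φ_β(𝒮_n)]`" for the random set `𝒮_n ⊂ Λ_{n-1}` (here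
  `half_le_dcpPhi_of_subset_box_pred`), whence Theorem 1.2 for `N₀ ≤ n ≤ L(β)` as printed (the
  rest of §2.2 — Lemmas 2.3–2.5 — holds for all `β ≤ β_c`, `n ≥ N₀`). The printed proof of
  Theorem 1.3 (end of §1.1: "Let `β ≤ β_c` and `n ≥ N₀`. … Divide the sum on the left-hand side
  of [the display of Theorem 1.2] according to whether `-n ≤ x₁ ≤ n/2` or `n/2 < x₁ ≤ n`")
  applies Theorem 1.2 AT THE SAME SCALE `n` and arrives at its last display
  `c₁/β ≤ C₄ ⟨τ₀τ_{(n/4)e₁}⟩_β (χ_n(β) + n^{d-2} Σ_{1≤k≤n/2} k⟨τ₀τ_{ke₁}⟩_β)`, "from which the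
  proof follows readily" — i.e. by renaming `n/4 ↦ n`, which turns `χ_n, Σ_{k≤n/2}` into the
  theorem's `χ_{4n}, Σ_{k≤2n}` and the range actually used, `N₀ ≤ n ≤ L(β)`, into
  `N₀ ≤ 4n ≤ L(β)`. Nothing printed covers `L(β)/4 < n ≤ L(β)` (the Messager–Miracle-Solé
  monotonicity `⟨τ₀τ_{ne₁}⟩ ≤ ⟨τ₀τ_{(n/4)e₁}⟩` goes the wrong way, and Theorem 1.2 at scale `4n`
  would need `φ_β(S) ≥ 1/2` for sets of diameter up to `8n - 2 > 2L(β)`), so the fact below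
  records the statement the source proves; the tree's own derivation of the critical slice from
  Theorem 1.2 (`dcp_criticalTwoPoint_axis_lower_of_reflectedGradient`,
  `CriticalTwoPointDCPLowerFromReflected.lean`) likewise applies Theorem 1.2 at scale `4n`. Later
  uses of the near-critical lower bound state its range up to such constants only
  (Liu–Panis–Slade, CMP 406 (2025), arXiv:2405.17353, §1: "`τ_β(0,x) ≥ c₀/|x|^{d-2}` for
  `‖x‖_∞ ≤ c₀(β_c - β)^{-1/2}`", `d > 4`).
* Elementary consequences of Definition 1.1 used in §2.2: `L(β) ≥ 1`; `φ_β({0}) = 2dβ`, so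
  `L(β) = 1` for `2dβ < 1/2` and `2 ≤ L(β) ⇒ β ≥ 1/(4d)` (the factor `1/β` of eq. (2.8) is
  harmless); and the sharp-length input of eq. (2.5): `0 ∈ S ⊆ Λ_{n-1}`, `2 ≤ n ≤ L(β)` ⇒
  `φ_β(S) ≥ 1/2`.

Deliberately NOT here: **Theorem 1.8** (`B(β_c) = ∞` for `d = 3, 4`) is ALREADY in the tree, as
conjunct (N1) of `Literature.Barriers.CriticalPhenomena.LaceExpansionIsingAboveFourNarrow`
(unpacked there: `LaceExpansionIsingAboveFourNarrow.not_bubbleCondition_three/_four`,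
`.bubbleDiagram_three_eq_top`, over `NNIsing.bubbleDiagram d β = Σ_x ⟨σ₀σ_x⟩²` on `twoPointFree`) —
consumers should take that hypothesis rather than a duplicate; Theorem 1.2 (the reflected
inequality) in the near-critical range; Theorems 1.4–1.7; `L(β_c) = ⊤` itself (a consequence of
(1.4) with Simon's lower bound, not a display of the source) is kept as an explicit hypothesis
where needed; the `φ⁴` / Griffiths–Simon-class versions.

## References

* H. Duminil-Copin, R. Panis, *New lower bounds for the (near) critical Ising and φ⁴ models'
  two-point functions*, Comm. Math. Phys. 406 (2025), arXiv:2404.05700 [DuminilCopinPanis2025LowerBounds]: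
  Def. 1.1, eq. (1.4), Thm. 1.3 (arXiv numbering, held).
-/

noncomputable section

open Finset
open scoped BigOperators Classical ENNReal

namespace Literature.Probability.LatticeModels

variable {d : ℕ}

/-! ### Definition 1.1: `φ_β(S)` and the sharp length -/

variable (d) in
/-- **`φ_β(S)`** (Duminil-Copin–Panis 2025, Def. 1.1):
`φ_β(S) = β Σ_{x ∈ S} Σ_{y ∉ S, y ∼ x} ⟨σ₀σ_x⟩_{S,β}` for a finite `S ⊂ ℤ^d`, with the finite-volume
free-boundary two-point function in `S` (the tree's `isingTwoPoint (zdGraph d) S β 0 .free 0 x`);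
the inner sum only counts the neighbours of `x` outside `S`. [cite: DuminilCopinPanis2025LowerBounds, Definition 1.1] -/
def dcpPhi (β : ℝ) (S : Finset (Site d)) : ℝ :=
  β * ∑ x ∈ S, ((((zdGraph d).neighborFinset x).filter fun y => y ∉ S).card : ℝ) *
    isingTwoPoint (zdGraph d) S β 0 .free 0 x

variable (d) in
/-- `k` is an **admissible scale for the sharp length**: `k ≥ 1` and some finite `S ∋ 0` of
sup-norm diameter `≤ 2k` has `φ_β(S) < 1/2` (Duminil-Copin–Panis 2025, Def. 1.1; `|·|` the sup
norm, `diam(S) = max |x − y|`). [cite: DuminilCopinPanis2025LowerBounds, Definition 1.1] -/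
def IsSharpLengthWitness (β : ℝ) (k : ℕ) : Prop :=
  1 ≤ k ∧ ∃ S : Finset (Site d), (0 : Site d) ∈ S ∧
    (∀ x ∈ S, ∀ y ∈ S, ‖x - y‖ ≤ 2 * (k : ℝ)) ∧ dcpPhi d β S < 1 / 2

variable (d) in
/-- **The sharp length** `L(β) = inf{k ≥ 1 : ∃ S ∋ 0, diam S ≤ 2k, φ_β(S) < 1/2} ∈ ℕ ∪ {∞}`
(Duminil-Copin–Panis 2025, Def. 1.1), in `ℕ∞` so that `inf ∅ = ⊤` (`L(β_c) = ∞`) is a value. [cite: DuminilCopinPanis2025LowerBounds, Definition 1.1] -/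
def sharpLength (β : ℝ) : ℕ∞ :=
  ⨅ (k : ℕ) (_ : IsSharpLengthWitness d β k), (k : ℕ∞)

/-- An admissible scale bounds the sharp length from above. [folklore] -/
theorem sharpLength_le {β : ℝ} {k : ℕ} (hk : IsSharpLengthWitness d β k) :
    sharpLength d β ≤ k :=
  iInf₂_le (f := fun (k : ℕ) (_ : IsSharpLengthWitness d β k) => (k : ℕ∞)) k hk

/-- If no scale is admissible the sharp length is `⊤`. [folklore] -/
theorem sharpLength_eq_top {β : ℝ} (h : ∀ k, ¬ IsSharpLengthWitness d β k) :
    sharpLength d β = ⊤ := by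
  simp [sharpLength, h]

/-- `n ≤ L(β)` means: every admissible scale is `≥ n`. [folklore] -/
theorem le_sharpLength_iff {β : ℝ} {n : ℕ} :
    (n : ℕ∞) ≤ sharpLength d β ↔ ∀ k, IsSharpLengthWitness d β k → n ≤ k := by
  simp [sharpLength, le_iInf_iff]

/-! ### Eq. (1.4): the near-critical plateau upper bound -/

/-- **Duminil-Copin–Panis 2025, eq. (1.4) (near-critical upper bound from Simon–Lieb + infrared
bound).** Printed: "there exist `c, C > 0` such that, if `β ≤ β_c` and `x ∈ ℤ^d ∖ {0}`,
`⟨τ₀τ_x⟩_β ≤ C (1/(|x| ∧ L(β)))^{d-2} exp(−c|x|/L(β))`." Here for `d ≥ 3`, `0 ≤ β ≤ β_c`, the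
free infinite-volume state `twoPointFree`, `|·|` the sup norm; split according to `L(β) = ⊤`
(bound `C/|x|^{d-2}`) or `L(β) = ℓ ∈ ℕ`. [cite: DuminilCopinPanis2025LowerBounds, eq. (1.4) (display after Definition 1.1)] -/
def dcp_nearCritical_upper : Prop :=
  ∀ (_hd : 3 ≤ d), ∃ c C : ℝ, 0 < c ∧ 0 < C ∧ ∀ β : ℝ, 0 ≤ β → β ≤ criticalBeta d →
    ∀ x : Site d, x ≠ 0 →
      (sharpLength d β = ⊤ → twoPointFree d β x ≤ C * (1 / ‖x‖) ^ (d - 2)) ∧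
      (∀ ℓ : ℕ, sharpLength d β = ℓ →
        twoPointFree d β x ≤ C * (1 / min ‖x‖ (ℓ : ℝ)) ^ (d - 2) * Real.exp (-(c * ‖x‖ / ℓ)))

/-! ### Theorem 1.3 in the near-critical range -/

/-- **Duminil-Copin–Panis 2025, Theorem 1.3 (pointwise axial lower bound, near-critical), in
the range its printed proof establishes.** Printed: "Let `d ≥ 3`. There exist `c₁, N₁ > 0` such
that for all `β ≤ β_c` and for all `N₁ ≤ n ≤ L(β)`,
`⟨τ₀τ_{ne₁}⟩_β ≥ c₁ / ( χ_{4n}(β) + n^{d-2} Σ_{1≤k≤2n} k ⟨τ₀τ_{ke₁}⟩_β )`."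
Here `0 ≤ β ≤ β_c`, `N₁ ≤ n`, and **`4n ≤ L(β)`** (in `ℕ∞`) instead of the printed `n ≤ L(β)`:
the printed proof (end of §1.1) applies Theorem 1.2 — proved for `N₀ ≤ m ≤ L(β)` only (§2.2,
eq. (2.5): `φ_β(𝒮_m) ≥ 1/2` for `𝒮_m ⊂ Λ_{m-1}`, cf. `half_le_dcpPhi_of_subset_box_pred`) — at a
scale `m` and concludes with the bound for `⟨τ₀τ_{(m/4)e₁}⟩_β` against
`χ_m(β) + m^{d-2} Σ_{k≤m/2} k⟨τ₀τ_{ke₁}⟩_β`, i.e. the display below with `m = 4n`; no printed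
argument reaches `L(β)/4 < n ≤ L(β)` (module docstring). Free state `twoPointFree`, `χ_{4n}`
written out over `box d (4n)`, `e₁ = Pi.single 0 1`. Its `β = β_c` slice (`L(β_c) = ⊤`, where
`4n ≤ ⊤` is no condition) is the accepted `dcp_criticalTwoPoint_axis_lower`. [cite: DuminilCopinPanis2025LowerBounds, Theorem 1.3] -/
def dcp_twoPoint_axis_lower_nearCritical : Prop :=
  ∀ (hd : 3 ≤ d), ∃ c₁ : ℝ, 0 < c₁ ∧ ∃ N₁ : ℕ, 0 < N₁ ∧ ∀ β : ℝ, 0 ≤ β → β ≤ criticalBeta d →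
    ∀ n : ℕ, N₁ ≤ n → ((4 * n : ℕ) : ℕ∞) ≤ sharpLength d β →
      c₁ / ((∑ x ∈ box d (4 * n), twoPointFree d β x) +
            (n : ℝ) ^ (d - 2) *
              ∑ k ∈ Finset.Icc 1 (2 * n),
                (k : ℝ) * twoPointFree d β (Pi.single (⟨0, by omega⟩ : Fin d) (k : ℤ)))
        ≤ twoPointFree d β (Pi.single (⟨0, by omega⟩ : Fin d) (n : ℤ))

/-- **Consistency with the critical slice.** The near-critical Theorem 1.3, together with
`L(β_c) = ⊤` (so that `4n ≤ L(β_c)` holds for every `n`), gives the `β = β_c` version — verbatim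
the body of the accepted named fact `dcp_criticalTwoPoint_axis_lower` of
`CriticalTwoPointDCPLower.lean` (not imported here, to keep the import closure minimal; the
statement below is that body, character for character). [cite: DuminilCopinPanis2025LowerBounds, Theorem 1.3] -/
theorem dcp_criticalTwoPoint_axis_lower_of_nearCritical
    (h : dcp_twoPoint_axis_lower_nearCritical (d := d))
    (hL : sharpLength d (criticalBeta d) = ⊤) :
    ∀ (hd : 3 ≤ d), ∃ c₁ : ℝ, 0 < c₁ ∧ ∃ N₁ : ℕ, 0 < N₁ ∧ ∀ n : ℕ, N₁ ≤ n →
      c₁ / ((∑ x ∈ box d (4 * n), twoPointFree d (criticalBeta d) x) +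
            (n : ℝ) ^ (d - 2) *
              ∑ k ∈ Finset.Icc 1 (2 * n),
                (k : ℝ) * twoPointFree d (criticalBeta d) (Pi.single (⟨0, by omega⟩ : Fin d) (k : ℤ)))
        ≤ twoPointFree d (criticalBeta d) (Pi.single (⟨0, by omega⟩ : Fin d) (n : ℤ)) := by
  intro hd
  obtain ⟨c₁, hc₁, N₁, hN₁, hmain⟩ := h hd
  refine ⟨c₁, hc₁, N₁, hN₁, fun n hn => ?_⟩
  exact hmain (criticalBeta d) (criticalBeta_nonneg d) le_rfl n hn (by rw [hL]; exact le_top)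


/-! ### Elementary properties of the sharp length (used in §2.2 of the source) -/

/-- `1 ≤ L(β)`: admissible scales are `≥ 1` by definition (and `⊤ ≥ 1`). [cite: DuminilCopinPanis2025LowerBounds, Definition 1.1] -/
theorem one_le_sharpLength {β : ℝ} : (1 : ℕ∞) ≤ sharpLength d β :=
  le_iInf₂ fun _ hk => by exact_mod_cast hk.1

/-- `φ_β({0}) = 2dβ`: the origin has `2d` neighbours (`card_neighborFinset_zdGraph_holds`), all
outside `{0}`, and `⟨σ₀σ₀⟩_{{0},β} = 1`. [cite: DuminilCopinPanis2025LowerBounds, Definition 1.1] -/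
theorem dcpPhi_singleton_zero (β : ℝ) : dcpPhi d β {0} = 2 * d * β := by
  unfold dcpPhi
  rw [Finset.sum_singleton, isingTwoPoint_self, mul_one]
  have hfilter : ((zdGraph d).neighborFinset 0).filter (fun y => y ∉ ({0} : Finset (Site d))) =
      (zdGraph d).neighborFinset 0 := by
    refine Finset.filter_true_of_mem fun y hy => ?_
    rw [Finset.mem_singleton]
    rintro rfl
    exact (zdGraph d).irrefl ((SimpleGraph.mem_neighborFinset _ _ _).1 hy)
  rw [hfilter, card_neighborFinset_zdGraph_holds (d := d) 0]
  push_cast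
  ring

/-- For `2dβ < 1/2` the scale `1` is admissible, witnessed by `S = {0}`. [cite: DuminilCopinPanis2025LowerBounds, Definition 1.1] -/
theorem isSharpLengthWitness_one {β : ℝ} (hβ : 2 * d * β < 1 / 2) : IsSharpLengthWitness d β 1 := by
  refine ⟨le_rfl, {0}, Finset.mem_singleton_self 0, fun x hx y hy => ?_, by rwa [dcpPhi_singleton_zero]⟩
  rw [Finset.mem_singleton] at hx hy
  subst hx; subst hy
  simp

/-- Hence `L(β) = 1` for `2dβ < 1/2` (in particular `L(0) = 1`). [cite: DuminilCopinPanis2025LowerBounds, Definition 1.1] -/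
theorem sharpLength_eq_one {β : ℝ} (hβ : 2 * d * β < 1 / 2) : sharpLength d β = 1 :=
  le_antisymm (by exact_mod_cast sharpLength_le (isSharpLengthWitness_one hβ)) one_le_sharpLength

/-- In the range of Theorems 1.2–1.3 the inverse temperature is bounded below: `2 ≤ L(β)` forces
`1/(4d) ≤ β` (contrapositive of `sharpLength_eq_one`). This is what makes the factor `1/β` of
§2.2, eq. (2.8) ("`c/(2β) ≤ 𝐄^∅_β[…]`") harmless. [cite: DuminilCopinPanis2025LowerBounds, Definition 1.1 and §2.2 eq. (2.8)] -/
theorem inv_le_of_two_le_sharpLength {β : ℝ} (h : (2 : ℕ∞) ≤ sharpLength d β) :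
    1 / (4 * (d : ℝ)) ≤ β := by
  by_contra hlt
  push Not at hlt
  have hβ : 2 * d * β < 1 / 2 := by
    rcases Nat.eq_zero_or_pos d with hd | hd
    · subst hd; simp
    · have hd' : (0 : ℝ) < d := by exact_mod_cast hd
      have h4 : β * (4 * d) < 1 := (lt_div_iff₀ (by positivity)).1 hlt
      nlinarith
  rw [sharpLength_eq_one hβ] at h
  exact absurd (show (2 : ℕ) ≤ 1 by exact_mod_cast h) (by norm_num)

/-- **The sharp-length input of §2.2** (sentence before eq. (2.5): "By definition of `L(β)`, if
`0 ≤ n ≤ L(β)` and `S ⊂ Λ_n`, then `φ_β(S) ≥ 1/2`", applied there to `𝒮_n ⊂ Λ_{n-1}`): a finite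
`S ∋ 0` of sup-norm diameter `≤ 2k` with `1 ≤ k < L(β)` has `φ_β(S) ≥ 1/2`. [cite: DuminilCopinPanis2025LowerBounds, §2.2, sentence before eq. (2.5)] -/
theorem half_le_dcpPhi_of_lt_sharpLength {β : ℝ} {k : ℕ} {S : Finset (Site d)} (hk : 1 ≤ k)
    (hkL : (k : ℕ∞) < sharpLength d β) (h0 : (0 : Site d) ∈ S)
    (hdiam : ∀ x ∈ S, ∀ y ∈ S, ‖x - y‖ ≤ 2 * (k : ℝ)) : 1 / 2 ≤ dcpPhi d β S := by
  by_contra hlt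
  push Not at hlt
  exact absurd hkL (not_lt.2 (sharpLength_le ⟨hk, S, h0, hdiam, hlt⟩))

/-- Box form of the same: `0 ∈ S ⊆ Λ_k` with `1 ≤ k < L(β)` gives `φ_β(S) ≥ 1/2` (points of `Λ_k`
are at sup distance `≤ 2k`). [cite: DuminilCopinPanis2025LowerBounds, §2.2, sentence before eq. (2.5)] -/
theorem half_le_dcpPhi_of_subset_box {β : ℝ} {k : ℕ} {S : Finset (Site d)} (hk : 1 ≤ k)
    (hkL : (k : ℕ∞) < sharpLength d β) (h0 : (0 : Site d) ∈ S) (hS : S ⊆ box d k) :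
    1 / 2 ≤ dcpPhi d β S := by
  refine half_le_dcpPhi_of_lt_sharpLength hk hkL h0 fun x hx y hy => ?_
  rw [pi_norm_le_iff_of_nonneg (by positivity)]
  intro i
  obtain ⟨h1, h2⟩ := mem_box.1 (hS hx) i
  obtain ⟨h3, h4⟩ := mem_box.1 (hS hy) i
  rw [Pi.sub_apply, Int.norm_eq_abs, abs_le]
  have h1' : -(k : ℝ) ≤ x i := by exact_mod_cast h1
  have h2' : (x i : ℝ) ≤ k := by exact_mod_cast h2
  have h3' : -(k : ℝ) ≤ y i := by exact_mod_cast h3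
  have h4' : (y i : ℝ) ≤ k := by exact_mod_cast h4
  push_cast
  constructor <;> linarith

/-- The form consumed by the proof of Theorem 1.2 at scale `n`: for `2 ≤ n ≤ L(β)`, every
`S ∋ 0` inside `Λ_{n-1}` — such as the random set `𝒮_n ⊂ Λ_{n-1}` of §2.2 — has `φ_β(S) ≥ 1/2`
(eq. (2.5)). [cite: DuminilCopinPanis2025LowerBounds, §2.2, eq. (2.5)] -/
theorem half_le_dcpPhi_of_subset_box_pred {β : ℝ} {n : ℕ} {S : Finset (Site d)} (hn : 2 ≤ n)
    (hnL : (n : ℕ∞) ≤ sharpLength d β) (h0 : (0 : Site d) ∈ S) (hS : S ⊆ box d (n - 1)) :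
    1 / 2 ≤ dcpPhi d β S :=
  half_le_dcpPhi_of_subset_box (k := n - 1) (by omega)
    (lt_of_lt_of_le (by exact_mod_cast (Nat.sub_lt (by omega) Nat.one_pos : n - 1 < n)) hnL) h0 hS

end Literature.Probability.LatticeModels
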